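import Literature.AlgebraicGeometry.HodgeTheory.SmallChowGroupsHodgeLevelAlgebraicCohomology
import Literature.AlgebraicGeometry.HodgeTheory.KunnethComponentsDiagonalAlgebraicPart
import Literature.AlgebraicGeometry.HodgeTheory.DivisorCupRaisesGeometricConiveau
import Literature.AlgebraicGeometry.HodgeTheory.AlgebraicClassesExteriorProduct
import Literature.AlgebraicGeometry.HodgeTheory.GysinBaseChange
import HarnessLib

/-!
# Geometric coniveau of PRODUCTS from the coniveau profiles of the factors: `Nʳ Hᵏ(Y × Z) = Hᵏ(Y × Z)` as soon as every Künneth pair `Hⁱ(Y) ⊗ Hʲ(Z)`, `i + j = k`, has `N^{ρ(i)} Hⁱ(Y) = Hⁱ(Y)`,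
# `N^{σ(j)} Hʲ(Z) = Hʲ(Z)`, `ρ(i) + σ(j) ≥ r`; the profile of a variety with small Chow groups (decomposition of the diagonal below the middle, hard Lefschetz above, zero odd groups); and Grothendieck's
# amended GHC in ALL bidegrees for `T × T'` (two threefolds with `CH₀ = ℤ`) and `X × X'` (two fivefolds with `CH₀ = CH₁ = ℚ`, e.g. two cubic fivefolds granted ELV)
# (Grothendieck 1969; Voisin I Thm. 11.38, Thm. 6.25; Voisin II Thm. 10.29/10.31, Prop. 9.20; Laterveer 1998; Bloch–Srinivas 1983; Voisin 2025 §4.3)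

Family `hodge`, lane `lit-hodgefound` (Track 2 foundations library; Layers A1/A4), layer `Literature/AlgebraicGeometry/HodgeTheory`.  THEOREMS ONLY (no definition, no named fact, no instance;
D-0026 net debt `0`).  Sequel of the seat's g33-#7/#9/#10 and of the tree's `MaxRationalSubHodgeStructureKunnethAlgebraicCohomology` (`supportedClasses_tensor_eq_top_of_forall_algebraic`: the case of
algebraic profiles `ρ(2a) = a`), `KunnethComponentsDiagonalAlgebraicPart` (`supportedClasses_eq_top_of_eq_top_of_add_eq_dim`: hard Lefschetz transports `Nᶜ Hᵏ = Hᵏ` to `N^{c+j} H^{k+2j} = H^{k+2j}`,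
`k + j = dim`), `AlgebraicClassesExteriorProduct` (`cupProduct_map_fst_map_snd_mem_supportedClasses`: `pr₁^* a ∪ pr₂^* b ∈ N^{r+s}` for `a ∈ Nʳ`, `b ∈ Nˢ`) and `GysinBaseChange` (`kunnethSpan_complexBetti`).

THE ARGUMENT.  (1) PRODUCTS: every class of `Hᵏ((Y × Z)(ℂ); ℂ)` is a combination of cross products `pr₁^* a ∪ pr₂^* b`, `deg a + deg b = k` (Künneth), and `a ∈ N^{ρ(i)} Hⁱ(Y)`, `b ∈ N^{σ(j)} Hʲ(Z)` give
`pr₁^* a ∪ pr₂^* b ∈ N^{ρ(i)+σ(j)} Hᵏ(Y × Z) ⊆ Nʳ` when `r ≤ ρ(i) + σ(j)` (Voisin I Thm. 11.38 + Voisin II Prop. 9.20: supports multiply); degrees `i > 2 dim Y` or `j > 2 dim Z` contribute nothing.  Then `GHC(Y × Z, k, r)`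
holds because `Nʳ Hᵏ` is everything.  (2) PROFILES of an `m`-fold `X` with `CH₀, …, CH_{k₀}` of rank `≤ 1` (`K = k₀ + 1`): below the middle `N^{min(K, ⌈i/2⌉)} Hⁱ = Hⁱ` (generalised decomposition of the
diagonal, g33-#9 §1); above the middle `N^{min(K, ⌈k/2⌉) + j} H^{k+2j} = H^{k+2j}` for `k + j = m` (hard Lefschetz: `Lʲ` is onto and raises the coniveau by `j`, the divisor class being algebraic); the odd
groups `H^{2p+1}`, `p ≤ k₀`, and their hard-Lefschetz mirrors VANISH (g33-#10), so any coniveau may be assigned to them.  (3) For `T × T'` (`k₀ = 0`, `m = 3`) the profile `i ↦ (0, ∞, 1, 1, 2, ∞, 3)` gives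
`Nʳ Hᵏ(T × T') = Hᵏ` for every cell `(k, r)`, `2r ≤ k ≤ 6`, except `(6, 3)`, which is `HC(T × T')` (the tree's `hodgeConjectureFor_tensor_threefolds_of_chowRankLEOneUpTo_zero`); by the hard-Lefschetz
reduction of `GHC` to the lower window this is ALL of `GHC(T × T')`.  For two fivefolds with `CH₀, CH₁` of rank `≤ 1` the profile `(0, ∞, 1, ∞, 2, 2, 3, ∞, 4, ∞, 5)` leaves only `(10, 5)` = `HC(X × X')` (g33-#7).

WHAT IS PROVED (`0` sorrys; every statement a theorem).
* §1 `supportedClasses_eq_top_of_subsingleton`; `supportedClasses_eq_top_of_chowRankLEOneUpTo_of_add_eq_dim` (the profile above the middle); **`supportedClasses_tensor_eq_top_of_forall_pieces`** and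
  **`generalHodgePropertyFor_tensor_of_forall_pieces`** (products, arbitrary profiles `ρ, σ`).
* §2 Algebraic-cohomology factors (g33-#10) times varieties with all of `GHC` (g33-#9): `forall_generalHodgePropertyFor_threefold_tensor_surface_of_chowRankLEOneUpTo_zero` (`T × S`, `CH₀` of rank `≤ 1` on both),
  `forall_generalHodgePropertyFor_threefold_tensor_fourfold_of_chowRankLEOneUpTo_zero_one` (`T × F`, `CH₀(T)`, `CH₀, CH₁(F)`), `forall_generalHodgePropertyFor_fourfold_tensor_fourfold_of_chowRankLEOneUpTo_zero_one`,
  `forall_generalHodgePropertyFor_fivefold_tensor_fourfold_of_chowRankLEOneUpTo_one_one`.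
* §3 The coniveau tables (private): a curve `(0, 0, 1)`; a threefold with `CH₀` of rank `≤ 1` `(0, ∞, 1, 1, 2, ∞, 3)`; a fivefold with `CH₀, CH₁` of rank `≤ 1` `(0, ∞, 1, ∞, 2, 2, 3, ∞, 4, ∞, 5)`.
* §4 ALL of Grothendieck's amended GHC, unconditionally, for: **`T × T'`** (two threefolds with `CH₀ ⊗ ℚ` of rank `≤ 1` — `forall_generalHodgePropertyFor_tensor_threefolds_of_chowRankLEOneUpTo_zero`), `C × T` and `T × C`
  (ANY curve), `C × X₅` and `X₅ × C` (fivefold with `CH₀, CH₁` of rank `≤ 1`, any curve), `T × X₅` and `X₅ × T`, **`X₅ × X₅'`** (`forall_generalHodgePropertyFor_tensor_fivefolds_of_chowRankLEOneUpTo_one`); granted the typed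
  ELV fact: two smooth cubic fivefolds, a curve times a smooth cubic fivefold.  In each case the only lower-window cell not settled by coniveau is the middle one, which is `HC` of the product (g33-#7 / the tree).

THE PRINTS.  A. Grothendieck (1969) [GrothendieckTopology1969] §1, pp. 300–301; C. Voisin (2002) [VoisinHodgeI2002] §11.3.3 Thm. 11.38, §6.2.3 Thm. 6.25, §7.1.2; C. Voisin (2003) [VoisinHodgeII2003] §9.2.4 Prop. 9.20, §10.3.1
Thm. 10.29, Thm. 10.31, §10.2.2 Thm. 10.17; R. Laterveer (1998) [Laterveer1998] main theorem; S. Bloch, V. Srinivas (1983) [BlochSrinivas1983] Thm. 1; C. Voisin (2025) [Voisin2025] §4.3, §5.2 Cor. 5.7; A. Hatcher (2002)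
[HatcherAT2002] §3.2 Thm. 3.16; H. Esnault, M. Levine, E. Viehweg (1997) [EsnaultLevineViehweg1997] Thm. 4.6; J. Murre (1994) [MurreTorino1994] §5.8.

THE OBJECTS (all the tree's).  `supportedClasses`, `complexBetti`, `cupProduct`, `complexBetti.map (fst/snd)`, `GeneralHodgePropertyFor`, `HodgeConjectureFor`, `Motives.ChowRankLEOneUpTo`, `Motives.IsSmoothCompleteIntersection`,
`Motives.EsnaultLevineViehweg1997_chowGroup_rank_le_one` (hypothesis only); the tree's `kunnethSpan_complexBetti`, `cupProduct_map_fst_map_snd_mem_supportedClasses`, `supportedClasses_mono`, `subsingleton_complexBetti`,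
`supportedClasses_eq_top_of_eq_top_of_add_eq_dim`, `supportedClasses_eq_top_of_le_of_add_eq_dim`, `forall_generalHodgePropertyFor_iff_lower_window`, `generalHodgePropertyFor_of_supportedClasses_eq_top`,
`generalHodgePropertyFor_two_mul_self_of_hodgeConjectureFor`, `hodgeConjectureFor_tensor_threefolds_of_chowRankLEOneUpTo_zero`, `forall_generalHodgePropertyFor_dim_three_of_chowRankLEOneUpTo_zero`, and the seat's
`supportedClasses_eq_top_of_chowRankLEOneUpTo_of_le`, `subsingleton_complexBetti_of_chowRankLEOneUpTo(_of_hardLefschetz)`, `forall_generalHodgePropertyFor_tensor_of_chowRankLEOneUpTo`,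
`forall_generalHodgePropertyFor_of_chowRankLEOneUpTo`, `forall_generalHodgePropertyFor_dim_four_of_chowRankLEOneUpTo_zero`, `hodgeConjectureFor_tensor_fivefolds_of_chowRankLEOneUpTo_one`, `chowRankLEOneUpTo_one_of_cubic_of_ELV`.

DEVIATIONS / SCOPE.  Complex orientations (through the tree's supported-classes lemmas).  The profiles are the ones delivered by the decomposition of the diagonal, hard Lefschetz and semipurity; no
claim that they are optimal.  §3 are full statements of Grothendieck's amended GHC for the products named; for other products the reader applies §1 with the profile lemmas (the only cells left are
the middle diagonal ones, i.e. `HC` of the product).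

## References
* [GrothendieckTopology1969] A. Grothendieck, Topology 8 (1969) — §1, pp. 300–301.
* [VoisinHodgeI2002] C. Voisin, *Hodge Theory and Complex Algebraic Geometry I* — §11.3.3 Thm. 11.38; §6.2.3 Thm. 6.25; §7.1.2.
* [VoisinHodgeII2003] C. Voisin, *Hodge Theory and Complex Algebraic Geometry II* — §9.2.4 Prop. 9.20; §10.3.1 Thm. 10.29, Thm. 10.31; §10.2.2 Thm. 10.17.
* [Laterveer1998] R. Laterveer, J. Math. Kyoto Univ. 38 (1998) — main theorem.
* [BlochSrinivas1983] S. Bloch, V. Srinivas, Amer. J. Math. 105 (1983) — Thm. 1.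
* [Voisin2025] C. Voisin (2025) — §4.3; §5.2 Cor. 5.7.
* [HatcherAT2002] A. Hatcher, *Algebraic Topology* — §3.2 Thm. 3.16.
* [EsnaultLevineViehweg1997] H. Esnault, M. Levine, E. Viehweg, Duke Math. J. 87 (1997) — Thm. 4.6.
* [MurreTorino1994] J. Murre, LNM 1594 — §5.8.

## Provenance
Lane `lit-hodgefound` (summit `HodgeConjecture`, Track 2 foundations), seat `lit-hodgefound-p29` (literature-prover, generation 33, row g33-#11).
-/

noncomputable section

open CategoryTheory AlgebraicGeometry MonoidalCategory CartesianMonoidalCategory Module Finset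
open Literature.AlgebraicTopology.SingularHomology
open Literature.Geometry.Kaehler

namespace Literature.AlgebraicGeometry.HodgeTheory

open Literature.AlgebraicGeometry.Motives

variable {n m : ℕ} {X Y Z C T T' F S : SchemeOver ℂ}

/-! ### §1 Profiles and products -/

variable (X) in
/-- A zero cohomology group has every coniveau: `Nʳ Hᵏ = Hᵏ` when `Hᵏ(X(ℂ); ℂ) = 0`. [cite: GrothendieckTopology1969, §1] -/
theorem supportedClasses_eq_top_of_subsingleton (k r : ℕ) [Subsingleton (complexBetti X k)] : supportedClasses X k r = ⊤ :=
  eq_top_iff.2 fun x _ ↦ by rw [Subsingleton.elim x 0]; exact Submodule.zero_mem _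

/-- **The coniveau profile of a variety with small Chow groups above the middle**: for `CH₀, …, CH_{k₀}` of rank `≤ 1`, `k + j = dim X`, `r ≤ k₀ + 1 + j` and `2r ≤ k + 1 + 2j`, one has
`Nʳ H^{k+2j}(X) = H^{k+2j}(X)` (`N^{r−j} Hᵏ = Hᵏ` by the generalised decomposition of the diagonal, transported by `Lʲ`, which is onto and raises the coniveau by `j`; for `r ≤ j` every class of degree
`k + 2j = dim X + j` has coniveau `j` anyway). [cite: VoisinHodgeII2003, Thm. 10.29, proof of Thm. 10.31 and §9.2.4 Prop. 9.20] [cite: VoisinHodgeI2002, §6.2.3 Thm. 6.25] [cite: Laterveer1998, main theorem (as quoted in Vial2013 Thm. 7.1)]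
[cite: Voisin2025, §4.3 (first paragraph)] -/
theorem supportedClasses_eq_top_of_chowRankLEOneUpTo_of_add_eq_dim (hX : IsSmoothProjective n X) {k₀ : ℕ} (hCH : ChowRankLEOneUpTo X k₀) {k j r : ℕ} (hkj : k + j = n) (hr : r ≤ k₀ + 1 + j)
    (hr' : 2 * r ≤ k + 1 + 2 * j) : supportedClasses X (k + 2 * j) r = ⊤ := by
  rcases Nat.lt_or_ge j r with hjr | hjr
  · obtain ⟨c, rfl⟩ : ∃ c, r = c + j := ⟨r - j, by omega⟩
    exact supportedClasses_eq_top_of_eq_top_of_add_eq_dim hX hkj (supportedClasses_eq_top_of_chowRankLEOneUpTo_of_le hX hCH (by omega) (by omega))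
  · exact supportedClasses_eq_top_of_le_of_add_eq_dim hX hkj rfl hjr

/-- **Coniveau of a product from the coniveau profiles of the factors**: if `N^{ρ(i)} Hⁱ(Y) = Hⁱ(Y)` for `i ≤ 2 dim Y`, `N^{σ(j)} Hʲ(Z) = Hʲ(Z)` for `j ≤ 2 dim Z`, and `r ≤ ρ(i) + σ(j)` whenever `i + j = k`, then
`Nʳ Hᵏ(Y × Z) = Hᵏ(Y × Z)` (Künneth: cross products span; `pr₁^* a ∪ pr₂^* b ∈ N^{ρ(i)+σ(j)}`). [cite: VoisinHodgeI2002, §11.3.3 Thm. 11.38] [cite: VoisinHodgeII2003, §9.2.4 Prop. 9.20] [cite: HatcherAT2002, §3.2 Thm. 3.16]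
[cite: GrothendieckTopology1969, §1] -/
theorem supportedClasses_tensor_eq_top_of_forall_pieces (hY : IsSmoothProjective m Y) (hZ : IsSmoothProjective n Z) (ρ σ : ℕ → ℕ) (hYs : ∀ i, i ≤ 2 * m → supportedClasses Y i (ρ i) = ⊤)
    (hZs : ∀ j, j ≤ 2 * n → supportedClasses Z j (σ j) = ⊤) {k r : ℕ} (h : ∀ i j, i + j = k → i ≤ 2 * m → j ≤ 2 * n → r ≤ ρ i + σ j) :
    supportedClasses (Y ⊗ Z) k r = ⊤ := by
  refine eq_top_iff.2 fun z _ ↦ (Submodule.span_le.2 ?_) (kunnethSpan_complexBetti hY hZ k z)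
  rintro _ ⟨i, j, hij, a, b, rfl⟩
  by_cases hi : i ≤ 2 * m
  · by_cases hj : j ≤ 2 * n
    · exact supportedClasses_mono (Y ⊗ Z) k (h i j hij hi hj) (cupProduct_map_fst_map_snd_mem_supportedClasses hY hZ hij
        (show a ∈ supportedClasses Y i (ρ i) by rw [hYs i hi]; exact Submodule.mem_top) (show b ∈ supportedClasses Z j (σ j) by rw [hZs j hj]; exact Submodule.mem_top))
    · haveI := subsingleton_complexBetti hZ (k := j) (by omega)
      rw [SetLike.mem_coe, Subsingleton.elim b 0, map_zero, map_zero]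
      exact Submodule.zero_mem _
  · haveI := subsingleton_complexBetti hY (k := i) (by omega)
    rw [SetLike.mem_coe, Subsingleton.elim a 0, map_zero, LinearMap.map_zero₂]
    exact Submodule.zero_mem _

/-- **`GHC(Y × Z, k, r)` from the coniveau profiles of the factors** (then `Nʳ Hᵏ(Y × Z)` is everything). [cite: GrothendieckTopology1969, §1, pp. 300–301] [cite: VoisinHodgeI2002, §11.3.3 Thm. 11.38] [cite: VoisinHodgeII2003, §9.2.4 Prop. 9.20] -/
theorem generalHodgePropertyFor_tensor_of_forall_pieces (hY : IsSmoothProjective m Y) (hZ : IsSmoothProjective n Z) (ρ σ : ℕ → ℕ) (hYs : ∀ i, i ≤ 2 * m → supportedClasses Y i (ρ i) = ⊤)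
    (hZs : ∀ j, j ≤ 2 * n → supportedClasses Z j (σ j) = ⊤) {k r : ℕ} (h : ∀ i j, i + j = k → i ≤ 2 * m → j ≤ 2 * n → r ≤ ρ i + σ j) :
    GeneralHodgePropertyFor (m + n) (Y ⊗ Z) k r :=
  generalHodgePropertyFor_of_supportedClasses_eq_top (hY.tensor_holds hZ) (supportedClasses_tensor_eq_top_of_forall_pieces hY hZ ρ σ hYs hZs h)

/-! ### §2 A factor with algebraic cohomology times a variety with all of `GHC` -/

/-- **ALL of `GHC(T × S)` for a threefold `T` and a surface `S` with `CH₀ ⊗ ℚ` of rank `≤ 1` on both** (`H*(S)` algebraic; all of `GHC(T)`, the tree's `forall_generalHodgePropertyFor_dim_three_of_chowRankLEOneUpTo_zero`).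
[cite: GrothendieckTopology1969, §1, pp. 300–301] [cite: BlochSrinivas1983, Thm. 1] [cite: VoisinHodgeI2002, §11.3.3 Thm. 11.38] [cite: MurreTorino1994, §5.8.1] -/
theorem forall_generalHodgePropertyFor_threefold_tensor_surface_of_chowRankLEOneUpTo_zero (hT : IsSmoothProjective 3 T) (hS : IsSmoothProjective 2 S) (hCHT : ChowRankLEOneUpTo T 0) (hCHS : ChowRankLEOneUpTo S 0)
    (i r : ℕ) : GeneralHodgePropertyFor (3 + 2) (T ⊗ S) i r :=
  forall_generalHodgePropertyFor_tensor_of_chowRankLEOneUpTo hT hS hCHS (by norm_num) (forall_generalHodgePropertyFor_dim_three_of_chowRankLEOneUpTo_zero hT hCHT) i r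

/-- **ALL of `GHC(T × F)` for a threefold `T` with `CH₀` of rank `≤ 1` and a fourfold `F` with `CH₀, CH₁` of rank `≤ 1`.** [cite: GrothendieckTopology1969, §1, pp. 300–301] [cite: VoisinHodgeII2003, Thm. 10.29 and Thm. 10.31]
[cite: BlochSrinivas1983, Thm. 1] -/
theorem forall_generalHodgePropertyFor_threefold_tensor_fourfold_of_chowRankLEOneUpTo_zero_one (hT : IsSmoothProjective 3 T) (hF : IsSmoothProjective 4 F) (hCHT : ChowRankLEOneUpTo T 0) (hCHF : ChowRankLEOneUpTo F 1)
    (i r : ℕ) : GeneralHodgePropertyFor (3 + 4) (T ⊗ F) i r :=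
  forall_generalHodgePropertyFor_tensor_of_chowRankLEOneUpTo hT hF hCHF (by norm_num) (forall_generalHodgePropertyFor_dim_three_of_chowRankLEOneUpTo_zero hT hCHT) i r

/-- **ALL of `GHC(F' × F)` for a fourfold `F'` with `CH₀` of rank `≤ 1` and a fourfold `F` with `CH₀, CH₁` of rank `≤ 1`** (all of `GHC(F')`, g33-#9). [cite: GrothendieckTopology1969, §1, pp. 300–301] [cite: VoisinHodgeII2003, Thm. 10.29 and Thm. 10.31]
[cite: BlochSrinivas1983, Thm. 1] -/
theorem forall_generalHodgePropertyFor_fourfold_tensor_fourfold_of_chowRankLEOneUpTo_zero_one {F' : SchemeOver ℂ} (hF' : IsSmoothProjective 4 F') (hF : IsSmoothProjective 4 F) (hCH' : ChowRankLEOneUpTo F' 0)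
    (hCHF : ChowRankLEOneUpTo F 1) (i r : ℕ) : GeneralHodgePropertyFor (4 + 4) (F' ⊗ F) i r :=
  forall_generalHodgePropertyFor_tensor_of_chowRankLEOneUpTo hF' hF hCHF (by norm_num) (forall_generalHodgePropertyFor_dim_four_of_chowRankLEOneUpTo_zero hF' hCH') i r

/-- **ALL of `GHC(X × F)` for a fivefold `X` with `CH₀, CH₁` of rank `≤ 1` and a fourfold `F` with `CH₀, CH₁` of rank `≤ 1`** (all of `GHC(X)`, g33-#9; `H*(F)` algebraic). [cite: GrothendieckTopology1969, §1, pp. 300–301]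
[cite: VoisinHodgeII2003, Thm. 10.29 and Thm. 10.31] -/
theorem forall_generalHodgePropertyFor_fivefold_tensor_fourfold_of_chowRankLEOneUpTo_one_one (hX : IsSmoothProjective 5 X) (hF : IsSmoothProjective 4 F) (hCH : ChowRankLEOneUpTo X 1) (hCHF : ChowRankLEOneUpTo F 1)
    (i r : ℕ) : GeneralHodgePropertyFor (5 + 4) (X ⊗ F) i r :=
  forall_generalHodgePropertyFor_tensor_of_chowRankLEOneUpTo hX hF hCHF (by norm_num) (forall_generalHodgePropertyFor_of_chowRankLEOneUpTo hX hCH (by norm_num)) i r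

/-! ### §3 Coniveau tables: a curve, a threefold with `CH₀ = ℤ`, a fivefold with `CH₀ = CH₁ = ℚ` -/

/-- **The coniveau table of a smooth projective CURVE**: `N⁰H⁰`, `N⁰H¹`, `N¹H²` are everything (`9` never occurs; the profile is `(0, 0, 1)`). [cite: GrothendieckTopology1969, §1] [cite: Voisin2025, §4.3 (first paragraph)] -/
private theorem tab_curve (hC : IsSmoothProjective 1 C) (i : ℕ) (hi : i ≤ 2 * 1) : supportedClasses C i ((fun i : ℕ ↦ if i = 2 then 1 else 0) i) = ⊤ := by
  interval_cases i
  · exact supportedClasses_zero C 0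
  · exact supportedClasses_zero C 1
  · exact supportedClasses_eq_top_of_dim_add_le hC (i := 2) (r := 1) (by norm_num)

/-- **The coniveau table of a smooth projective THREEFOLD with `CH₀ ⊗ ℚ` of rank `≤ 1`**: profile `(0, ∞, 1, 1, 2, ∞, 3)` (`∞` rendered as `9`: `H¹ = H⁵ = 0`; `N¹H²`, `N¹H³` by Bloch–Srinivas, `N²H⁴`, `N³H⁶`
by hard Lefschetz). [cite: BlochSrinivas1983, Thm. 1] [cite: VoisinHodgeII2003, §10.2.2 Thm. 10.17, Cor. 10.18 and Thm. 10.29] [cite: VoisinHodgeI2002, §6.2.3 Thm. 6.25] [cite: Voisin2025, §5.2 Cor. 5.7] -/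
private theorem tab_threefold (hV : IsSmoothProjective 3 T) (hCHV : ChowRankLEOneUpTo T 0) (i : ℕ) (hi : i ≤ 2 * 3) :
    supportedClasses T i ((fun i : ℕ ↦ if i = 0 then 0 else if i = 2 ∨ i = 3 then 1 else if i = 4 then 2 else if i = 6 then 3 else 9) i) = ⊤ := by
  interval_cases i
  · exact supportedClasses_zero T 0
  · haveI : Subsingleton (complexBetti T 1) := subsingleton_complexBetti_of_chowRankLEOneUpTo hV hCHV (p := 0) le_rfl
    exact supportedClasses_eq_top_of_subsingleton T 1 9
  · exact supportedClasses_eq_top_of_chowRankLEOneUpTo_of_le hV hCHV (by norm_num) (by norm_num)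
  · exact supportedClasses_eq_top_of_chowRankLEOneUpTo_of_le hV hCHV (by norm_num) (by norm_num)
  · exact supportedClasses_eq_top_of_chowRankLEOneUpTo_of_add_eq_dim hV hCHV (k := 2) (j := 1) (by norm_num) (by norm_num) (by norm_num)
  · haveI : Subsingleton (complexBetti T 5) := subsingleton_complexBetti_of_chowRankLEOneUpTo_of_hardLefschetz hV hCHV ⟨2, by norm_num⟩ (by norm_num) (by norm_num)
    exact supportedClasses_eq_top_of_subsingleton T 5 9
  · exact supportedClasses_eq_top_of_chowRankLEOneUpTo_of_add_eq_dim hV hCHV (k := 0) (j := 3) (by norm_num) (by norm_num) (by norm_num)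

/-- **The coniveau table of a smooth projective FIVEFOLD with `CH₀, CH₁ ⊗ ℚ` of rank `≤ 1`**: profile `(0, ∞, 1, ∞, 2, 2, 3, ∞, 4, ∞, 5)` (`∞` rendered as `9`: `H¹ = H³ = H⁷ = H⁹ = 0`; `N¹H²`, `N²H⁴`, `N²H⁵` by the
generalised decomposition of the diagonal, `N³H⁶`, `N⁴H⁸`, `N⁵H¹⁰` by hard Lefschetz). [cite: VoisinHodgeII2003, Thm. 10.29 and proof of Thm. 10.31] [cite: Laterveer1998, main theorem (as quoted in Vial2013 Thm. 7.1)] [cite: VoisinHodgeI2002, §6.2.3 Thm. 6.25] -/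
private theorem tab_fivefold (hV : IsSmoothProjective 5 X) (hCHV : ChowRankLEOneUpTo X 1) (i : ℕ) (hi : i ≤ 2 * 5) :
    supportedClasses X i ((fun i : ℕ ↦ if i = 0 then 0 else if i = 2 then 1 else if i = 4 ∨ i = 5 then 2 else if i = 6 then 3 else if i = 8 then 4 else if i = 10 then 5 else 9) i) = ⊤ := by
  interval_cases i
  · exact supportedClasses_zero X 0
  · haveI : Subsingleton (complexBetti X 1) := subsingleton_complexBetti_of_chowRankLEOneUpTo hV hCHV (p := 0) (by norm_num)
    exact supportedClasses_eq_top_of_subsingleton X 1 9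
  · exact supportedClasses_eq_top_of_chowRankLEOneUpTo_of_le hV hCHV (by norm_num) (by norm_num)
  · haveI : Subsingleton (complexBetti X 3) := subsingleton_complexBetti_of_chowRankLEOneUpTo hV hCHV (p := 1) le_rfl
    exact supportedClasses_eq_top_of_subsingleton X 3 9
  · exact supportedClasses_eq_top_of_chowRankLEOneUpTo_of_le hV hCHV (by norm_num) (by norm_num)
  · exact supportedClasses_eq_top_of_chowRankLEOneUpTo_of_le hV hCHV (by norm_num) (by norm_num)
  · exact supportedClasses_eq_top_of_chowRankLEOneUpTo_of_add_eq_dim hV hCHV (k := 4) (j := 1) (by norm_num) (by norm_num) (by norm_num)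
  · haveI : Subsingleton (complexBetti X 7) := subsingleton_complexBetti_of_chowRankLEOneUpTo_of_hardLefschetz hV hCHV ⟨3, by norm_num⟩ (by norm_num) (by norm_num)
    exact supportedClasses_eq_top_of_subsingleton X 7 9
  · exact supportedClasses_eq_top_of_chowRankLEOneUpTo_of_add_eq_dim hV hCHV (k := 2) (j := 3) (by norm_num) (by norm_num) (by norm_num)
  · haveI : Subsingleton (complexBetti X 9) := subsingleton_complexBetti_of_chowRankLEOneUpTo_of_hardLefschetz hV hCHV ⟨4, by norm_num⟩ (by norm_num) (by norm_num)
    exact supportedClasses_eq_top_of_subsingleton X 9 9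
  · exact supportedClasses_eq_top_of_chowRankLEOneUpTo_of_add_eq_dim hV hCHV (k := 0) (j := 5) (by norm_num) (by norm_num) (by norm_num)

/-! ### §4 All of Grothendieck's amended GHC for eight products -/

/-- **ALL of Grothendieck's amended `GHC` for `T × T'`, two smooth projective THREEFOLDS with `CH₀ ⊗ ℚ` of rank `≤ 1`** (e.g. two rationally connected / Fano threefolds with `CH₀ = ℤ`) — unconditionally: every
lower-window cell `(k, r)` of the sixfold `T × T'` has `Nʳ Hᵏ = Hᵏ` by §1 and the threefold table, except `(6, 3)`, which is `HC(T × T')` (g33-#7 `hodgeConjectureFor_tensor_of_chowRankLEOneUpTo`; the tree's `hodgeConjectureFor_tensor_threefolds_of_chowRankLEOneUpTo_zero`).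
[cite: GrothendieckTopology1969, §1, pp. 300–301] [cite: BlochSrinivas1983, Thm. 1] [cite: VoisinHodgeII2003, §10.2.2 Thm. 10.17, Thm. 10.29 and §9.2.4 Prop. 9.20] [cite: VoisinHodgeI2002, §11.3.3 Thm. 11.38 and §6.2.3 Thm. 6.25]
[cite: Voisin2025, §4.3 and §5.2 Cor. 5.7] [cite: MurreTorino1994, §5.8.1] -/
theorem forall_generalHodgePropertyFor_tensor_threefolds_of_chowRankLEOneUpTo_zero (hT : IsSmoothProjective 3 T) (hT' : IsSmoothProjective 3 T') (hCH : ChowRankLEOneUpTo T 0) (hCH' : ChowRankLEOneUpTo T' 0)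
    (i r : ℕ) : GeneralHodgePropertyFor (3 + 3) (T ⊗ T') i r := by
  refine (forall_generalHodgePropertyFor_iff_lower_window (hT.tensor_holds hT')).2 (fun k r hr h2 hk _ ↦ ?_) i r
  by_cases hc : k = 6 ∧ r = 3
  · obtain ⟨rfl, rfl⟩ := hc
    exact generalHodgePropertyFor_two_mul_self_of_hodgeConjectureFor (hT.tensor_holds hT')
      (hodgeConjectureFor_tensor_of_chowRankLEOneUpTo hT hT' hCH hCH' (by norm_num) (by norm_num) (by norm_num)) 3
  · refine generalHodgePropertyFor_tensor_of_forall_pieces hT hT' _ _ (tab_threefold hT hCH) (tab_threefold hT' hCH') fun a b hab ha hb ↦ ?_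
    split_ifs <;> omega

/-- **ALL of `GHC` for `C × T`**: ANY smooth projective curve `C`, a smooth projective threefold `T` with `CH₀ ⊗ ℚ` of rank `≤ 1` (the only cell not settled by coniveau is `(4, 2)` = `HC(C × T)`, g33-#7).
[cite: GrothendieckTopology1969, §1, pp. 300–301] [cite: BlochSrinivas1983, Thm. 1] [cite: VoisinHodgeII2003, §10.2.2 Thm. 10.17 and §9.2.4 Prop. 9.20] [cite: VoisinHodgeI2002, §11.3.3 Thm. 11.38] [cite: MurreTorino1994, §5.8.1] -/
theorem forall_generalHodgePropertyFor_curve_tensor_threefold_of_chowRankLEOneUpTo_zero (hC : IsSmoothProjective 1 C) (hT : IsSmoothProjective 3 T) (hCH : ChowRankLEOneUpTo T 0) (i r : ℕ) :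
    GeneralHodgePropertyFor (1 + 3) (C ⊗ T) i r := by
  refine (forall_generalHodgePropertyFor_iff_lower_window (hC.tensor_holds hT)).2 (fun k r hr h2 hk _ ↦ ?_) i r
  by_cases hc : k = 4 ∧ r = 2
  · obtain ⟨rfl, rfl⟩ := hc
    exact generalHodgePropertyFor_two_mul_self_of_hodgeConjectureFor (hC.tensor_holds hT) (hodgeConjectureFor_tensor_of_dim_le_three_of_chowRankLEOneUpTo hC hT hCH (by norm_num) (by norm_num)) 2
  · refine generalHodgePropertyFor_tensor_of_forall_pieces hC hT _ _ (tab_curve hC) (tab_threefold hT hCH) fun a b hab ha hb ↦ ?_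
    split_ifs <;> omega

/-- Mirror: **ALL of `GHC` for `T × C`**, `CH₀(T) ⊗ ℚ` of rank `≤ 1`, `C` any curve. [cite: GrothendieckTopology1969, §1, pp. 300–301] [cite: BlochSrinivas1983, Thm. 1] [cite: VoisinHodgeI2002, §11.3.3 Thm. 11.38] -/
theorem forall_generalHodgePropertyFor_threefold_tensor_curve_of_chowRankLEOneUpTo_zero (hT : IsSmoothProjective 3 T) (hC : IsSmoothProjective 1 C) (hCH : ChowRankLEOneUpTo T 0) (i r : ℕ) :
    GeneralHodgePropertyFor (3 + 1) (T ⊗ C) i r := by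
  refine (forall_generalHodgePropertyFor_iff_lower_window (hT.tensor_holds hC)).2 (fun k r hr h2 hk _ ↦ ?_) i r
  by_cases hc : k = 4 ∧ r = 2
  · obtain ⟨rfl, rfl⟩ := hc
    exact generalHodgePropertyFor_two_mul_self_of_hodgeConjectureFor (hT.tensor_holds hC) (hodgeConjectureFor_tensor_of_chowRankLEOneUpTo_of_dim_le_three hT hC hCH (by norm_num) (by norm_num)) 2
  · refine generalHodgePropertyFor_tensor_of_forall_pieces hT hC _ _ (tab_threefold hT hCH) (tab_curve hC) fun a b hab ha hb ↦ ?_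
    split_ifs <;> omega

/-- **ALL of `GHC` for `C × X`**: ANY smooth projective curve `C`, a smooth projective FIVEFOLD `X` with `CH₀, CH₁ ⊗ ℚ` of rank `≤ 1` (e.g. a smooth cubic fivefold granted ELV); the cell `(6, 3)` is `HC(C × X)` (g33-#7).
[cite: GrothendieckTopology1969, §1, pp. 300–301] [cite: VoisinHodgeII2003, Thm. 10.29, proof of Thm. 10.31 and §9.2.4 Prop. 9.20] [cite: VoisinHodgeI2002, §11.3.3 Thm. 11.38 and §6.2.3 Thm. 6.25] -/
theorem forall_generalHodgePropertyFor_curve_tensor_fivefold_of_chowRankLEOneUpTo_one (hC : IsSmoothProjective 1 C) (hX : IsSmoothProjective 5 X) (hCH : ChowRankLEOneUpTo X 1) (i r : ℕ) :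
    GeneralHodgePropertyFor (1 + 5) (C ⊗ X) i r := by
  refine (forall_generalHodgePropertyFor_iff_lower_window (hC.tensor_holds hX)).2 (fun k r hr h2 hk _ ↦ ?_) i r
  by_cases hc : k = 6 ∧ r = 3
  · obtain ⟨rfl, rfl⟩ := hc
    exact generalHodgePropertyFor_two_mul_self_of_hodgeConjectureFor (hC.tensor_holds hX) (hodgeConjectureFor_curve_tensor_fivefold_of_chowRankLEOneUpTo_one hC hX hCH) 3
  · refine generalHodgePropertyFor_tensor_of_forall_pieces hC hX _ _ (tab_curve hC) (tab_fivefold hX hCH) fun a b hab ha hb ↦ ?_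
    split_ifs <;> omega

/-- Mirror: **ALL of `GHC` for `X × C`**, `X` a fivefold with `CH₀, CH₁` of rank `≤ 1`, `C` any curve. [cite: GrothendieckTopology1969, §1, pp. 300–301] [cite: VoisinHodgeII2003, Thm. 10.29 and proof of Thm. 10.31] -/
theorem forall_generalHodgePropertyFor_fivefold_tensor_curve_of_chowRankLEOneUpTo_one (hX : IsSmoothProjective 5 X) (hC : IsSmoothProjective 1 C) (hCH : ChowRankLEOneUpTo X 1) (i r : ℕ) :
    GeneralHodgePropertyFor (5 + 1) (X ⊗ C) i r := by
  refine (forall_generalHodgePropertyFor_iff_lower_window (hX.tensor_holds hC)).2 (fun k r hr h2 hk _ ↦ ?_) i r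
  by_cases hc : k = 6 ∧ r = 3
  · obtain ⟨rfl, rfl⟩ := hc
    exact generalHodgePropertyFor_two_mul_self_of_hodgeConjectureFor (hX.tensor_holds hC) (hodgeConjectureFor_fivefold_tensor_curve_of_chowRankLEOneUpTo_one hX hC hCH) 3
  · refine generalHodgePropertyFor_tensor_of_forall_pieces hX hC _ _ (tab_fivefold hX hCH) (tab_curve hC) fun a b hab ha hb ↦ ?_
    split_ifs <;> omega

/-- **ALL of `GHC` for `T × X`**: a threefold `T` with `CH₀` of rank `≤ 1` and a fivefold `X` with `CH₀, CH₁` of rank `≤ 1` (the cell `(8, 4)` is `HC(T × X)`, g33-#7). [cite: GrothendieckTopology1969, §1, pp. 300–301]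
[cite: BlochSrinivas1983, Thm. 1] [cite: VoisinHodgeII2003, Thm. 10.17, Thm. 10.29, proof of Thm. 10.31 and §9.2.4 Prop. 9.20] [cite: VoisinHodgeI2002, §11.3.3 Thm. 11.38 and §6.2.3 Thm. 6.25] -/
theorem forall_generalHodgePropertyFor_threefold_tensor_fivefold_of_chowRankLEOneUpTo_zero_one (hT : IsSmoothProjective 3 T) (hX : IsSmoothProjective 5 X) (hCHT : ChowRankLEOneUpTo T 0)
    (hCH : ChowRankLEOneUpTo X 1) (i r : ℕ) : GeneralHodgePropertyFor (3 + 5) (T ⊗ X) i r := by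
  refine (forall_generalHodgePropertyFor_iff_lower_window (hT.tensor_holds hX)).2 (fun k r hr h2 hk _ ↦ ?_) i r
  by_cases hc : k = 8 ∧ r = 4
  · obtain ⟨rfl, rfl⟩ := hc
    exact generalHodgePropertyFor_two_mul_self_of_hodgeConjectureFor (hT.tensor_holds hX) (hodgeConjectureFor_threefold_tensor_fivefold_of_chowRankLEOneUpTo_zero_one hT hX hCHT hCH) 4
  · refine generalHodgePropertyFor_tensor_of_forall_pieces hT hX _ _ (tab_threefold hT hCHT) (tab_fivefold hX hCH) fun a b hab ha hb ↦ ?_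
    split_ifs <;> omega

/-- Mirror: **ALL of `GHC` for `X × T`**, fivefold with `CH₀, CH₁` and threefold with `CH₀` of rank `≤ 1`. [cite: GrothendieckTopology1969, §1, pp. 300–301] [cite: VoisinHodgeII2003, Thm. 10.29 and proof of Thm. 10.31] [cite: BlochSrinivas1983, Thm. 1] -/
theorem forall_generalHodgePropertyFor_fivefold_tensor_threefold_of_chowRankLEOneUpTo_one_zero (hX : IsSmoothProjective 5 X) (hT : IsSmoothProjective 3 T) (hCH : ChowRankLEOneUpTo X 1)
    (hCHT : ChowRankLEOneUpTo T 0) (i r : ℕ) : GeneralHodgePropertyFor (5 + 3) (X ⊗ T) i r := by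
  refine (forall_generalHodgePropertyFor_iff_lower_window (hX.tensor_holds hT)).2 (fun k r hr h2 hk _ ↦ ?_) i r
  by_cases hc : k = 8 ∧ r = 4
  · obtain ⟨rfl, rfl⟩ := hc
    exact generalHodgePropertyFor_two_mul_self_of_hodgeConjectureFor (hX.tensor_holds hT) (hodgeConjectureFor_fivefold_tensor_threefold_of_chowRankLEOneUpTo_one_zero hX hT hCH hCHT) 4
  · refine generalHodgePropertyFor_tensor_of_forall_pieces hX hT _ _ (tab_fivefold hX hCH) (tab_threefold hT hCHT) fun a b hab ha hb ↦ ?_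
    split_ifs <;> omega

/-- **ALL of Grothendieck's amended `GHC` for `X × X'`, two smooth projective FIVEFOLDS with `CH₀, CH₁` of rank `≤ 1`** — unconditionally; the only cell not settled by coniveau is `(10, 5)` = `HC(X × X')`
(g33-#7 `hodgeConjectureFor_tensor_fivefolds_of_chowRankLEOneUpTo_one`). [cite: GrothendieckTopology1969, §1, pp. 300–301] [cite: VoisinHodgeII2003, Thm. 10.29, proof of Thm. 10.31 and §9.2.4 Prop. 9.20]
[cite: Laterveer1998, main theorem (as quoted in Vial2013 Thm. 7.1)] [cite: VoisinHodgeI2002, §11.3.3 Thm. 11.38 and §6.2.3 Thm. 6.25] [cite: Voisin2025, §4.3] -/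
theorem forall_generalHodgePropertyFor_tensor_fivefolds_of_chowRankLEOneUpTo_one {X' : SchemeOver ℂ} (hX : IsSmoothProjective 5 X) (hX' : IsSmoothProjective 5 X') (hCH : ChowRankLEOneUpTo X 1)
    (hCH' : ChowRankLEOneUpTo X' 1) (i r : ℕ) : GeneralHodgePropertyFor (5 + 5) (X ⊗ X') i r := by
  refine (forall_generalHodgePropertyFor_iff_lower_window (hX.tensor_holds hX')).2 (fun k r hr h2 hk _ ↦ ?_) i r
  by_cases hc : k = 10 ∧ r = 5
  · obtain ⟨rfl, rfl⟩ := hc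
    exact generalHodgePropertyFor_two_mul_self_of_hodgeConjectureFor (hX.tensor_holds hX') (hodgeConjectureFor_tensor_fivefolds_of_chowRankLEOneUpTo_one hX hX' hCH hCH') 5
  · refine generalHodgePropertyFor_tensor_of_forall_pieces hX hX' _ _ (tab_fivefold hX hCH) (tab_fivefold hX' hCH') fun a b hab ha hb ↦ ?_
    split_ifs <;> omega

/-- **ALL of Grothendieck's amended `GHC` for the product of two smooth cubic FIVEFOLDS `X, X' ⊂ ℙ⁶_ℂ`, granted Esnault–Levine–Viehweg** (`CH₀ = CH₁ = ℚ`). [cite: EsnaultLevineViehweg1997, Thm 4.6 (announced as Thm 4.5 in the Introduction), first bullet]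
[cite: GrothendieckTopology1969, §1, pp. 300–301] [cite: VoisinHodgeII2003, Thm. 10.29 and proof of Thm. 10.31] [cite: Vial2013, §7.2.2] -/
theorem forall_generalHodgePropertyFor_tensor_cubicFivefolds_of_ELV {X' : SchemeOver ℂ} (hR : EsnaultLevineViehweg1997_chowGroup_rank_le_one.{0}) (hX : IsSmoothCompleteIntersection 5 (fun _ : Fin 1 ↦ 3) X)
    (hX' : IsSmoothCompleteIntersection 5 (fun _ : Fin 1 ↦ 3) X') (i r : ℕ) : GeneralHodgePropertyFor (5 + 5) (X ⊗ X') i r :=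
  forall_generalHodgePropertyFor_tensor_fivefolds_of_chowRankLEOneUpTo_one hX.1 hX'.1 (chowRankLEOneUpTo_one_of_cubic_of_ELV hR hX (by norm_num))
    (chowRankLEOneUpTo_one_of_cubic_of_ELV hR hX' (by norm_num)) i r

/-- **ALL of `GHC` for `C × Y`, any curve `C` and a smooth cubic fivefold `Y ⊂ ℙ⁶_ℂ`, granted ELV.** [cite: EsnaultLevineViehweg1997, Thm 4.6 (announced as Thm 4.5 in the Introduction), first bullet] [cite: GrothendieckTopology1969, §1, pp. 300–301]
[cite: VoisinHodgeII2003, Thm. 10.29 and proof of Thm. 10.31] -/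
theorem forall_generalHodgePropertyFor_curve_tensor_cubicFivefold_of_ELV (hR : EsnaultLevineViehweg1997_chowGroup_rank_le_one.{0}) (hC : IsSmoothProjective 1 C) (hX : IsSmoothCompleteIntersection 5 (fun _ : Fin 1 ↦ 3) X)
    (i r : ℕ) : GeneralHodgePropertyFor (1 + 5) (C ⊗ X) i r :=
  forall_generalHodgePropertyFor_curve_tensor_fivefold_of_chowRankLEOneUpTo_one hC hX.1 (chowRankLEOneUpTo_one_of_cubic_of_ELV hR hX (by norm_num)) i r

end Literature.AlgebraicGeometry.HodgeTheory

end
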